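import Summits.AtomisticToContinuum.FouriersLaw.Theses.HoelderEscapeProfile
import Literature.MathematicalPhysics.KineticTheory.InfiniteChainGibbsExistenceShift
import Literature.MathematicalPhysics.KineticTheory.InfiniteChainShiftInvariantUniqueness
import Literature.MathematicalPhysics.KineticTheory.InfiniteChainSuperstableReversal

/-!
# `FibreCalculus` (stmt-AtomisticToContinuum-16011): the a.e.-carrier conjunct of `PreservesMeasure` is load-bearing

Negative lemma (crux disprover, load-bearing analysis) for the crux
`Summit.AtomisticToContinuum.FouriersLaw.Theses.HoelderEscapeProfile.FibreCalculus` (route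
`HoelderEscapeProfile`, sub-problem `FouriersLaw`). In the crux the dynamics `D` enters the twelve
conclusions ONLY through integrals against `μ`, and Newton's equations enter ONLY through the first
conjunct of `D.PreservesMeasure μ = (∀ᵐ σ ∂μ, σ ∈ D.carrier) ∧ ∀ t, MeasurePreserving (D.flow t) μ μ`
(orbits are solutions on the carrier, and the carrier is `μ`-full). We show that this conjunct cannot
be dropped: with `PreservesMeasure` weakened to "every `D.flow t` is `μ`-measure-preserving", the
statement is FALSE — unconditionally, using the tree's shift-invariant DLR state of the pinned chain
(`exists_isChainGibbsMeasure_shiftInvariant_superstable_pinnedChain`), its uniqueness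
(`eq_of_isChainGibbsMeasure_of_isShiftInvariant_pinnedChain`) and the resulting momentum-reversal
symmetry (`map_momentumReversalZ_eq_of_regular_unique`).

Witness ("JUMP" dynamics): carrier `∅` (so the solution/uniqueness fields are vacuous), `φ_0 = id`
and `φ_t = τ` (the lattice shift) for `t ≠ 0`, resp. `φ_t = τ⁻¹`. Both preserve `μ`, commute with
`τ`, and `μ` is Gibbs, shift- and reversal-invariant, so every weakened guard holds. For `φ_t = τ^{±1}`
the Abel profile is the STATIC covariance read one site off, `S̄_ν(x) = S₀(x ± 1)` for every `ν > 0`,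
while `S(x,0) = S₀(x)` and `C_T(t)` is a `t`-independent constant `C_±` for `t > 0`; Helfand–Abel
(clause (12)) at `ν = 1, 2` reads `C_± = (ν²/2)(Σ_x x²S₀(x±1) − Σ_x x²S₀(x))`, forcing
`Σ_x x²S₀(x+1) = Σ_x x²S₀(x) = Σ_x x²S₀(x−1)`; re-indexing (clause (5) gives the summability) the
sum of the two identities is `2Σ_x S₀(x) = 0`, contradicting clause (6) `0 < χ(0) = Σ_x S₀(x)`.
Reading for provers: any proof of (11)/(12) must use `D.isSolution` through the a.e.-carrier clause —
measure preservation, shift covariance and all symmetries of `μ` are blind to the equations of motion.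
No statement of the route is asserted here.
-/

noncomputable section

open MeasureTheory Filter Set

namespace Summit.AtomisticToContinuum.FouriersLaw.Theorems.FibreCalculus.Negative

open Literature.MathematicalPhysics.KineticTheory.HeatConduction

/-- **`FibreCalculus` is false when `D.PreservesMeasure μ` is weakened to "each `D.flow t` preserves
`μ`"** (the a.e.-carrier conjunct dropped). The displayed statement is `HoelderEscapeProfile.FibreCalculus`
VERBATIM except that the guard `D.PreservesMeasure μ` is replaced by
`∀ t : ℝ, MeasurePreserving (D.flow t) μ μ`; it is refuted at `ω₂ = lam = β = T = 1`, `γ = 0` by the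
symmetric DLR state of the tree and the two jump dynamics `φ_t = τ^{±1}` (`t ≠ 0`), `φ_0 = id`, via
clauses (5), (6), (12). [folklore] -/
theorem fibreCalculus_false_without_carrierAE :
    ¬ (∀ ω₂ lam β γ : ℝ, 0 < ω₂ → 0 < lam → 0 < β → ∀ T : ℝ, 0 < T → ∀ μ : MeasureTheory.Measure Literature.MathematicalPhysics.KineticTheory.HeatConduction.ChainConfig, (Literature.MathematicalPhysics.KineticTheory.HeatConduction.pinnedChain ω₂ lam β γ).IsChainGibbsMeasure T μ → Literature.MathematicalPhysics.KineticTheory.HeatConduction.IsShiftInvariant μ → μ.map (fun σ : Literature.MathematicalPhysics.KineticTheory.HeatConduction.ChainConfig => fun x : ℤ => ((σ x).1, -(σ x).2)) = μ → ∀ D : Literature.MathematicalPhysics.KineticTheory.HeatConduction.InfiniteChainDynamics (Literature.MathematicalPhysics.KineticTheory.HeatConduction.pinnedChain ω₂ lam β γ), (∀ t : ℝ, MeasureTheory.MeasurePreserving (D.flow t) μ μ) → (∀ t : ℝ, ∀ᵐ σ ∂μ, D.flow t (Literature.MathematicalPhysics.KineticTheory.HeatConduction.shift σ) = Literature.MathematicalPhysics.KineticTheory.HeatConduction.shift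 (D.flow t σ)) → ∀ h : Literature.MathematicalPhysics.KineticTheory.HeatConduction.ChainConfig → ℤ → ℝ, h = (fun (σ : Literature.MathematicalPhysics.KineticTheory.HeatConduction.ChainConfig) (x : ℤ) => (σ x).2 ^ 2 / 2 + (Literature.MathematicalPhysics.KineticTheory.HeatConduction.pinnedChain ω₂ lam β γ).U (σ x).1 + ((Literature.MathematicalPhysics.KineticTheory.HeatConduction.pinnedChain ω₂ lam β γ).V ((σ (x + 1)).1 - (σ x).1) + (Literature.MathematicalPhysics.KineticTheory.HeatConduction.pinnedChain ω₂ lam β γ).V ((σ x).1 - (σ (x - 1)).1)) / 2) → ∀ S : ℤ → ℝ → ℝ, S = (fun (x : ℤ) (t : ℝ) => ∫ σ, (h σ 0 - ∫ σ', h σ' 0 ∂μ) * (h (D.flow t σ) x - ∫ σ', h σ' 0 ∂μ) ∂μ) → ∀ Sb : ℝ → ℤ → ℝ, Sb = (fun (ν : ℝ) (x : ℤ) => ν * ∫ t in Set.Ioi (0:ℝ), Real.exp (-(ν * t)) * S x t) → ∀ G : ℤ → ℝ → ℝ, G = (fun (x : ℤ) (t : ℝ) => ∫ σ, (Literature.MathematicalPhysics.KineticTheory.HeatConduction.pinnedChain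 ω₂ lam β γ).bondCurrentZ σ 0 * (Literature.MathematicalPhysics.KineticTheory.HeatConduction.pinnedChain ω₂ lam β γ).bondCurrentZ (D.flow t σ) x ∂μ) → ∀ Gh : ℝ → ℝ → ℝ, Gh = (fun (ν k : ℝ) => ∫ t in Set.Ioi (0:ℝ), Real.exp (-(ν * t)) * ∑' x : ℤ, Real.cos (k * (x : ℝ)) * G x t) → ∀ fh : ℝ → ℝ → ℝ, fh = (fun (ν k : ℝ) => ∑' x : ℤ, Real.cos (k * (x : ℝ)) * Sb ν x) → ∀ χk : ℝ → ℝ, χk = (fun k : ℝ => ∑' x : ℤ, Real.cos (k * (x : ℝ)) * S x 0) → (∀ t : ℝ, D.HasAbsConvergentCorrelation μ t) ∧ (∀ ν : ℝ, 0 < ν → MeasureTheory.IntegrableOn (fun t : ℝ => Real.exp (-(ν * t)) * D.currentCorrelation μ t) (Set.Ioi 0)) ∧ (∀ x : ℤ, ∀ ν : ℝ, 0 < ν → MeasureTheory.IntegrableOn (fun t : ℝ => Real.exp (-(ν * t)) * S x t) (Set.Ioi 0)) ∧ (∀ ν : ℝ, 0 < ν → Summable (fun x : ℤ => (1 + (x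 : ℝ) ^ 2) * |Sb ν x|)) ∧ Summable (fun x : ℤ => (1 + (x : ℝ) ^ 2) * |S x 0|) ∧ 0 < χk 0 ∧ (∀ ν : ℝ, 0 < ν → ∑' x : ℤ, Sb ν x = χk 0) ∧ (∀ ν : ℝ, 0 < ν → ∀ k : ℝ, 0 ≤ fh ν k) ∧ (∀ ν : ℝ, 0 < ν → ∫ k in (-Real.pi)..Real.pi, fh ν k = 2 * Real.pi * Sb ν 0) ∧ (∀ ν : ℝ, 0 < ν → ∀ k : ℝ, MeasureTheory.IntegrableOn (fun t : ℝ => Real.exp (-(ν * t)) * ∑' x : ℤ, Real.cos (k * (x : ℝ)) * G x t) (Set.Ioi 0)) ∧ (∀ ν : ℝ, 0 < ν → ∀ k : ℝ, χk k - fh ν k = (2 - 2 * Real.cos k) * Gh ν k / ν) ∧ (∀ ν : ℝ, 0 < ν → ∫ t in Set.Ioi (0:ℝ), Real.exp (-(ν * t)) * D.currentCorrelation μ t = ν / 2 * ((∑' x : ℤ, (x : ℝ) ^ 2 * Sb ν x) - ∑' x : ℤ, (x : ℝ) ^ 2 * S x 0))) := by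
  intro H
  -- the pinned chain at ω₂ = lam = β = 1, γ = 0, temperature T = 1
  -- (1) the symmetric DLR state of the tree: shift-invariant, superstable, hence reversal-invariant
  obtain ⟨μ, hG, hS, hSS⟩ :=
    OscillatorChain.exists_isChainGibbsMeasure_shiftInvariant_superstable_pinnedChain
      (ω₂ := 1) (lam := 1) (β := 1) (0 : ℝ) one_pos zero_le_one zero_le_one (T := 1) one_pos
  have hR' : μ.map momentumReversalZ = μ :=
    OscillatorChain.map_momentumReversalZ_eq_of_regular_unique (P := pinnedChain 1 1 1 0) hG hS hSS
      (fun μ₁ μ₂ h₁ s₁ _ h₂ s₂ _ =>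
        OscillatorChain.eq_of_isChainGibbsMeasure_of_isShiftInvariant_pinnedChain 0 one_pos
          zero_le_one zero_le_one one_pos h₁ s₁ h₂ s₂)
  have hR : μ.map (fun σ : ChainConfig => fun x : ℤ => ((σ x).1, -(σ x).2)) = μ := hR'
  haveI : IsProbabilityMeasure μ := hG.isProbabilityMeasure
  -- (2) the two JUMP dynamics: empty carrier, `φ_0 = id`, `φ_t = τ^{±1}` for `t ≠ 0`
  have hsymm : ∀ (τ' : ChainConfig) (y : ℤ), shiftEquiv.symm τ' y = τ' (y - 1) := fun _ _ => rfl
  let Dp : InfiniteChainDynamics (pinnedChain 1 1 1 0) :=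
    { carrier := ∅
      flow := fun t σ => if t = 0 then σ else shift σ
      mapsTo := fun _ => Set.mapsTo_empty _ _
      flow_zero := fun σ hσ => by simp at hσ
      isSolution := fun σ hσ => by simp at hσ
      unique := fun c hc _ _ => by simpa using hc 0 }
  let Dm : InfiniteChainDynamics (pinnedChain 1 1 1 0) :=
    { carrier := ∅
      flow := fun t σ => if t = 0 then σ else shiftEquiv.symm σ
      mapsTo := fun _ => Set.mapsTo_empty _ _
      flow_zero := fun σ hσ => by simp at hσ
      isSolution := fun σ hσ => by simp at hσ
      unique := fun c hc _ _ => by simpa using hc 0 }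
  have hp0 : ∀ σ, Dp.flow 0 σ = σ := fun σ => by
    show (if (0 : ℝ) = 0 then σ else shift σ) = σ
    rw [if_pos rfl]
  have hpt : ∀ t : ℝ, t ≠ 0 → ∀ σ, Dp.flow t σ = shift σ := fun t ht σ => by
    show (if t = 0 then σ else shift σ) = shift σ
    rw [if_neg ht]
  have hm0 : ∀ σ, Dm.flow 0 σ = σ := fun σ => by
    show (if (0 : ℝ) = 0 then σ else shiftEquiv.symm σ) = σ
    rw [if_pos rfl]
  have hmt : ∀ t : ℝ, t ≠ 0 → ∀ σ, Dm.flow t σ = shiftEquiv.symm σ := fun t ht σ => by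
    show (if t = 0 then σ else shiftEquiv.symm σ) = shiftEquiv.symm σ
    rw [if_neg ht]
  have hMPp : ∀ t : ℝ, MeasurePreserving (Dp.flow t) μ μ := by
    intro t
    by_cases ht : t = 0
    · have e : Dp.flow t = id := funext fun σ => by rw [ht]; exact hp0 σ
      rw [e]; exact MeasurePreserving.id μ
    · have e : Dp.flow t = shift := funext fun σ => hpt t ht σ
      rw [e]; exact ⟨shift_measurable, hS⟩
  have hMPm : ∀ t : ℝ, MeasurePreserving (Dm.flow t) μ μ := by
    intro t
    by_cases ht : t = 0
    · have e : Dm.flow t = id := funext fun σ => by rw [ht]; exact hm0 σ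
      rw [e]; exact MeasurePreserving.id μ
    · have e : Dm.flow t = shiftEquiv.symm := funext fun σ => hmt t ht σ
      rw [e]; exact ⟨shiftEquiv.symm.measurable, hS.map_shiftEquiv_symm⟩
  have hCp : ∀ t : ℝ, ∀ᵐ σ ∂μ, Dp.flow t (shift σ) = shift (Dp.flow t σ) := by
    intro t
    refine Eventually.of_forall fun σ => ?_
    by_cases ht : t = 0
    · rw [ht, hp0, hp0]
    · rw [hpt t ht, hpt t ht]
  have hCm : ∀ t : ℝ, ∀ᵐ σ ∂μ, Dm.flow t (shift σ) = shift (Dm.flow t σ) := by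
    intro t
    refine Eventually.of_forall fun σ => ?_
    by_cases ht : t = 0
    · rw [ht, hm0, hm0]
    · rw [hmt t ht, hmt t ht]
      have e1 : shiftEquiv.symm (shift σ) = σ := shiftEquiv.symm_apply_apply σ
      have e2 : shift (shiftEquiv.symm σ) = σ := shiftEquiv.apply_symm_apply σ
      rw [e1, e2]
  -- (3) the static objects
  obtain ⟨E, hE⟩ : ∃ E : ChainConfig → ℤ → ℝ, E = fun (σ : ChainConfig) (x : ℤ) =>
      (σ x).2 ^ 2 / 2 + (pinnedChain 1 1 1 0).U (σ x).1 +
        ((pinnedChain 1 1 1 0).V ((σ (x + 1)).1 - (σ x).1) +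
          (pinnedChain 1 1 1 0).V ((σ x).1 - (σ (x - 1)).1)) / 2 := ⟨_, rfl⟩
  have hEshift : ∀ (σ : ChainConfig) (x : ℤ), E (shift σ) x = E σ (x + 1) := by
    intro σ x
    simp only [hE, shift, sub_add_cancel, add_sub_cancel_right]
  have hEunshift : ∀ (σ : ChainConfig) (x : ℤ), E (shiftEquiv.symm σ) x = E σ (x - 1) := by
    intro σ x
    simp only [hE, hsymm, sub_add_cancel, add_sub_cancel_right]
  obtain ⟨S0, hS0⟩ : ∃ S0 : ℤ → ℝ, S0 = fun x : ℤ =>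
      ∫ σ, (E σ 0 - ∫ σ', E σ' 0 ∂μ) * (E σ x - ∫ σ', E σ' 0 ∂μ) ∂μ := ⟨_, rfl⟩
  -- (4) instantiate the weakened statement at both jump dynamics
  obtain ⟨-, -, -, -, h5, h6, -, -, -, -, -, hp12⟩ :=
    H 1 1 1 0 one_pos one_pos one_pos 1 one_pos μ hG hS hR Dp hMPp hCp E hE _ rfl _ rfl _ rfl _ rfl
      _ rfl _ rfl
  obtain ⟨-, -, -, -, -, -, -, -, -, -, -, hm12⟩ :=
    H 1 1 1 0 one_pos one_pos one_pos 1 one_pos μ hG hS hR Dm hMPm hCm E hE _ rfl _ rfl _ rfl _ rfl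
      _ rfl _ rfl
  -- (5) read clauses (5), (6) in static terms
  have hSx0 : ∀ x : ℤ, ∫ σ, (E σ 0 - ∫ σ', E σ' 0 ∂μ) * (E (Dp.flow 0 σ) x - ∫ σ', E σ' 0 ∂μ) ∂μ =
      S0 x := fun x => by simp only [hp0, hS0]
  have h5' : Summable fun x : ℤ => (1 + (x : ℝ) ^ 2) * |S0 x| := by
    simpa only [hSx0] using h5
  have h6' : 0 < ∑' x : ℤ, S0 x := by
    simpa only [hSx0, zero_mul, Real.cos_zero, one_mul] using h6
  -- `∫₀^∞ e^{-νt} dt = 1/ν`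
  have hexp : ∀ ν : ℝ, 0 < ν → ∫ t in Ioi (0:ℝ), Real.exp (-(ν * t)) = 1 / ν := by
    intro ν hν
    have h := integral_exp_mul_Ioi (neg_lt_zero.2 hν) 0
    simp only [mul_zero, Real.exp_zero, neg_mul] at h
    rw [h, neg_div_neg_eq]
  -- Abel profiles of the jump dynamics: the static covariance read one site off, for EVERY ν > 0
  have hSbp : ∀ ν : ℝ, 0 < ν → ∀ x : ℤ,
      ν * ∫ t in Ioi (0:ℝ), Real.exp (-(ν * t)) *
        ∫ σ, (E σ 0 - ∫ σ', E σ' 0 ∂μ) * (E (Dp.flow t σ) x - ∫ σ', E σ' 0 ∂μ) ∂μ = S0 (x + 1) := by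
    intro ν hν x
    have e : ∫ t in Ioi (0:ℝ), Real.exp (-(ν * t)) *
        ∫ σ, (E σ 0 - ∫ σ', E σ' 0 ∂μ) * (E (Dp.flow t σ) x - ∫ σ', E σ' 0 ∂μ) ∂μ =
        ∫ t in Ioi (0:ℝ), Real.exp (-(ν * t)) * S0 (x + 1) := by
      refine setIntegral_congr_fun measurableSet_Ioi fun t ht => ?_
      have ht' : t ≠ 0 := ne_of_gt ht
      simp only [hpt t ht', hEshift, hS0]
    rw [e, integral_mul_const, hexp ν hν]
    field_simp
  have hSbm : ∀ ν : ℝ, 0 < ν → ∀ x : ℤ,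
      ν * ∫ t in Ioi (0:ℝ), Real.exp (-(ν * t)) *
        ∫ σ, (E σ 0 - ∫ σ', E σ' 0 ∂μ) * (E (Dm.flow t σ) x - ∫ σ', E σ' 0 ∂μ) ∂μ = S0 (x - 1) := by
    intro ν hν x
    have e : ∫ t in Ioi (0:ℝ), Real.exp (-(ν * t)) *
        ∫ σ, (E σ 0 - ∫ σ', E σ' 0 ∂μ) * (E (Dm.flow t σ) x - ∫ σ', E σ' 0 ∂μ) ∂μ =
        ∫ t in Ioi (0:ℝ), Real.exp (-(ν * t)) * S0 (x - 1) := by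
      refine setIntegral_congr_fun measurableSet_Ioi fun t ht => ?_
      have ht' : t ≠ 0 := ne_of_gt ht
      simp only [hmt t ht', hEunshift, hS0]
    rw [e, integral_mul_const, hexp ν hν]
    field_simp
  have hSx0m : ∀ x : ℤ, ∫ σ, (E σ 0 - ∫ σ', E σ' 0 ∂μ) * (E (Dm.flow 0 σ) x - ∫ σ', E σ' 0 ∂μ) ∂μ =
      S0 x := fun x => by simp only [hm0, hS0]
  -- Abel transforms of the (constant on t > 0) current correlations of the jump dynamics
  have hJp : ∀ ν : ℝ, 0 < ν → ∫ t in Ioi (0:ℝ), Real.exp (-(ν * t)) * Dp.currentCorrelation μ t =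
      1 / ν * ∑' x : ℤ, ∫ σ, (pinnedChain 1 1 1 0).bondCurrentZ σ 0 *
        (pinnedChain 1 1 1 0).bondCurrentZ (shift σ) x ∂μ := by
    intro ν hν
    have e : ∫ t in Ioi (0:ℝ), Real.exp (-(ν * t)) * Dp.currentCorrelation μ t =
        ∫ t in Ioi (0:ℝ), Real.exp (-(ν * t)) * ∑' x : ℤ, ∫ σ, (pinnedChain 1 1 1 0).bondCurrentZ σ 0 *
          (pinnedChain 1 1 1 0).bondCurrentZ (shift σ) x ∂μ := by
      refine setIntegral_congr_fun measurableSet_Ioi fun t ht => ?_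
      have ht' : t ≠ 0 := ne_of_gt ht
      simp only [InfiniteChainDynamics.currentCorrelation, hpt t ht']
    rw [e, integral_mul_const, hexp ν hν]
  have hJm : ∀ ν : ℝ, 0 < ν → ∫ t in Ioi (0:ℝ), Real.exp (-(ν * t)) * Dm.currentCorrelation μ t =
      1 / ν * ∑' x : ℤ, ∫ σ, (pinnedChain 1 1 1 0).bondCurrentZ σ 0 *
        (pinnedChain 1 1 1 0).bondCurrentZ (shiftEquiv.symm σ) x ∂μ := by
    intro ν hν
    have e : ∫ t in Ioi (0:ℝ), Real.exp (-(ν * t)) * Dm.currentCorrelation μ t =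
        ∫ t in Ioi (0:ℝ), Real.exp (-(ν * t)) * ∑' x : ℤ, ∫ σ, (pinnedChain 1 1 1 0).bondCurrentZ σ 0 *
          (pinnedChain 1 1 1 0).bondCurrentZ (shiftEquiv.symm σ) x ∂μ := by
      refine setIntegral_congr_fun measurableSet_Ioi fun t ht => ?_
      have ht' : t ≠ 0 := ne_of_gt ht
      simp only [InfiniteChainDynamics.currentCorrelation, hmt t ht']
    rw [e, integral_mul_const, hexp ν hν]
  -- (6) Helfand–Abel (clause (12)) for the jump dynamics, in static terms, for every ν > 0
  have hgenp : ∀ ν : ℝ, 0 < ν → 1 / ν * (∑' x : ℤ, ∫ σ, (pinnedChain 1 1 1 0).bondCurrentZ σ 0 *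
        (pinnedChain 1 1 1 0).bondCurrentZ (shift σ) x ∂μ) =
      ν / 2 * ((∑' x : ℤ, (x : ℝ) ^ 2 * S0 (x + 1)) - ∑' x : ℤ, (x : ℝ) ^ 2 * S0 x) := by
    intro ν hν
    have h := hp12 ν hν
    rw [hJp ν hν] at h
    simpa only [hSbp ν hν, hSx0] using h
  have hgenm : ∀ ν : ℝ, 0 < ν → 1 / ν * (∑' x : ℤ, ∫ σ, (pinnedChain 1 1 1 0).bondCurrentZ σ 0 *
        (pinnedChain 1 1 1 0).bondCurrentZ (shiftEquiv.symm σ) x ∂μ) =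
      ν / 2 * ((∑' x : ℤ, (x : ℝ) ^ 2 * S0 (x - 1)) - ∑' x : ℤ, (x : ℝ) ^ 2 * S0 x) := by
    intro ν hν
    have h := hm12 ν hν
    rw [hJm ν hν] at h
    simpa only [hSbm ν hν, hSx0m] using h
  -- ν = 1 and ν = 2 force the second Abel moments to agree
  have hQp : (∑' x : ℤ, (x : ℝ) ^ 2 * S0 (x + 1)) = ∑' x : ℤ, (x : ℝ) ^ 2 * S0 x := by
    have h1 := hgenp 1 one_pos
    have h2 := hgenp 2 two_pos
    norm_num at h1 h2
    linarith
  have hQm : (∑' x : ℤ, (x : ℝ) ^ 2 * S0 (x - 1)) = ∑' x : ℤ, (x : ℝ) ^ 2 * S0 x := by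
    have h1 := hgenm 1 one_pos
    have h2 := hgenm 2 two_pos
    norm_num at h1 h2
    linarith
  -- (7) re-index the shifted second moments
  have hRp : (∑' x : ℤ, (x : ℝ) ^ 2 * S0 (x + 1)) = ∑' y : ℤ, ((y : ℝ) - 1) ^ 2 * S0 y := by
    rw [← (Equiv.addRight (1 : ℤ)).tsum_eq (fun y : ℤ => ((y : ℝ) - 1) ^ 2 * S0 y)]
    refine tsum_congr fun x => ?_
    simp only [Equiv.coe_addRight, Int.cast_add, Int.cast_one, add_sub_cancel_right]
  have hRm : (∑' x : ℤ, (x : ℝ) ^ 2 * S0 (x - 1)) = ∑' y : ℤ, ((y : ℝ) + 1) ^ 2 * S0 y := by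
    rw [← (Equiv.subRight (1 : ℤ)).tsum_eq (fun y : ℤ => ((y : ℝ) + 1) ^ 2 * S0 y)]
    refine tsum_congr fun x => ?_
    simp only [Equiv.subRight_apply, Int.cast_sub, Int.cast_one, sub_add_cancel]
  -- (8) summabilities from clause (5)
  have hs2 : Summable fun y : ℤ => (y : ℝ) ^ 2 * S0 y := by
    refine Summable.of_norm_bounded h5' fun y => ?_
    rw [Real.norm_eq_abs, abs_mul, abs_of_nonneg (sq_nonneg _)]
    exact mul_le_mul_of_nonneg_right (by linarith [sq_nonneg (y : ℝ)]) (abs_nonneg _)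
  have hs0 : Summable S0 := by
    refine Summable.of_norm_bounded h5' fun y => ?_
    rw [Real.norm_eq_abs]
    have h1 : (1 : ℝ) ≤ 1 + (y : ℝ) ^ 2 := by nlinarith [sq_nonneg (y : ℝ)]
    calc |S0 y| = 1 * |S0 y| := (one_mul _).symm
      _ ≤ (1 + (y : ℝ) ^ 2) * |S0 y| := mul_le_mul_of_nonneg_right h1 (abs_nonneg _)
  have hsm : Summable fun y : ℤ => ((y : ℝ) - 1) ^ 2 * S0 y := by
    refine Summable.of_norm_bounded (h5'.mul_left 2) fun y => ?_
    rw [Real.norm_eq_abs, abs_mul, abs_of_nonneg (sq_nonneg _)]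
    have h1 : ((y : ℝ) - 1) ^ 2 ≤ 2 * (1 + (y : ℝ) ^ 2) := by nlinarith [sq_nonneg ((y : ℝ) + 1)]
    calc ((y : ℝ) - 1) ^ 2 * |S0 y| ≤ 2 * (1 + (y : ℝ) ^ 2) * |S0 y| :=
        mul_le_mul_of_nonneg_right h1 (abs_nonneg _)
      _ = 2 * ((1 + (y : ℝ) ^ 2) * |S0 y|) := by ring
  have hsp : Summable fun y : ℤ => ((y : ℝ) + 1) ^ 2 * S0 y := by
    refine Summable.of_norm_bounded (h5'.mul_left 2) fun y => ?_
    rw [Real.norm_eq_abs, abs_mul, abs_of_nonneg (sq_nonneg _)]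
    have h1 : ((y : ℝ) + 1) ^ 2 ≤ 2 * (1 + (y : ℝ) ^ 2) := by nlinarith [sq_nonneg ((y : ℝ) - 1)]
    calc ((y : ℝ) + 1) ^ 2 * |S0 y| ≤ 2 * (1 + (y : ℝ) ^ 2) * |S0 y| :=
        mul_le_mul_of_nonneg_right h1 (abs_nonneg _)
      _ = 2 * ((1 + (y : ℝ) ^ 2) * |S0 y|) := by ring
  -- (9) `(y+1)² + (y-1)² - 2y² = 2`: the two identities sum to `2 Σ S0 = 0`, contradicting (6)
  have key : (∑' y : ℤ, ((y : ℝ) + 1) ^ 2 * S0 y) + (∑' y : ℤ, ((y : ℝ) - 1) ^ 2 * S0 y)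
      - 2 * ∑' y : ℤ, (y : ℝ) ^ 2 * S0 y = 2 * ∑' y : ℤ, S0 y := by
    rw [← hsp.tsum_add hsm, ← hs2.tsum_mul_left 2, ← hs0.tsum_mul_left 2,
      ← (hsp.add hsm).tsum_sub (hs2.mul_left 2)]
    refine tsum_congr fun y => ?_
    ring
  have hzero : ∑' y : ℤ, S0 y = 0 := by
    rw [hRp] at hQp
    rw [hRm] at hQm
    linarith
  rw [hzero] at h6'
  exact lt_irrefl _ h6' 

end Summit.AtomisticToContinuum.FouriersLaw.Theorems.FibreCalculus.Negative

end
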